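import Literature.NumberTheory.Sieve.HeathBrownCubicTypeIILocalise
import HarnessLib

/-!
# Heath-Brown's Lemma 3.10, §12 pp. 73–74: counting the Class II hypercubes (`O(N⁵)`)

Support for the proof of **Lemma 3.10** of D. R. Heath-Brown, *Primes represented by `x³ + 2y³`*,
Acta Math. 186 (2001), §12 pp. 73–74:

> "Our next task is to make a trivial estimate for `S(II)`. To do this we shall begin by bounding the number
> of Class II hypercubes, using Lemma 4.9. Each Class II hypercube contains a point for which one of the
> equations `N(β_i) = V` or `2V`, `β_i³ = N(β_i)ε₀^{∓3/2}`, `p_i(β₁,β₂) = XD` or `XD(1+η)`,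
> `q_i(β₁,β₂) = XD` or `XD(1+η)` (`i = 1` or `2`) holds. … In each case we therefore find that the vertices
> of the hypercube satisfy an equation of the form `F_i(n₁,…,n₆) = H_i' + O(N²)`, with `H_i'` fixed. We now
> observe that the polynomials `F_i` are non-singular in the relevant region … we deduce that
> `|∇F(𝐧)| ≫ N²`, as required. We may therefore apply Lemma 4.9 … to show that there are `O(N⁵)` Class II
> hypercubes."

This file PROVES the counting half: the number of index pairs `(𝐧, 𝐧') ∈ Nrange²` at whose corner one of
the sixteen "near-boundary" conditions holds is `O(N⁵)`. In place of the general Lemma 4.9 we use the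
structure of the forms (`HeathBrownCubicTypeIIForms`): the window conditions are linear (slab count), the
`p_i, q_i` are linear in the other variable with gradient `≫ N²` by the adjugate identity (slab count for
each fixed `𝐧`), and `N(β) = V, 2V` is a one-variable cubic along the coordinate whose adjugate is largest
(`card_le_of_cubic_near_level`):

* `normFormZ`, `adjMax`, `adjMax_ge` (`max|adj(𝐧)| ≥ |N(𝐧)|/(5|𝐧|_∞)`), `card_filter_prod_eq_sum`;
* **`card_ell_near_le`** (`#{(𝐧,𝐧') : |ell(𝐧) − h| ≤ 8} ≤ 12 (6N+3)⁵`),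
  **`card_p1_near_le`**, **`card_q1_near_le`** (`#{(𝐧,𝐧') : |p₁(𝐧,𝐧') − h| ≤ 8000N², |N(𝐧)| ≥ N³/2} ≤ 640001 (6N+3)⁵`),
  **`card_norm_near_le`** (`#{(𝐧,𝐧') : |N(𝐧) − h| ≤ 1248N², |N(𝐧)| ≥ N³/2} ≤ 2.1·10⁹ (6N+3)⁵`),
  and the swapped versions `card_swap_filter`.

## References

* D. R. Heath-Brown, *Primes represented by `x³ + 2y³`*, Acta Math. 186 (2001), §12 pp. 73–74, Lemma 4.9
  p. 26. [cite: HeathBrownActa2001, §12 pp. 73–74]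

## Mathlib / tree search

Tree: `HeathBrownCubicLatticeGeometry` (`card_filter_abs_dot_sub_le`, `card_le_of_cubic_near_level`, `supZ`),
`HeathBrownCubicTypeIIForms` (`gradP`, `gradQ`, `adjA/B/C`, `adj_identity`, `p1Z_eq`, `q1Z_eq`),
`HeathBrownCubicTypeIILocalise` (`Nrange`), `HeathBrownCubicWindow` (`rho`, `ell`).
-/

noncomputable section

open Finset NumberField

namespace Literature.NumberTheory.Sieve.CubicSieve

open LFunctions.CubeRootTwoField CubicPrimes

/-! ### Preliminaries -/

/-- The integer norm form `N(𝐧) = n₁³ + 2n₂³ + 4n₃³ − 6n₁n₂n₃`. [cite: HeathBrownActa2001, Lemma 8.1] -/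
def normFormZ (n : ℤ × ℤ × ℤ) : ℤ := n.1 ^ 3 + 2 * n.2.1 ^ 3 + 4 * n.2.2 ^ 3 - 6 * n.1 * n.2.1 * n.2.2

/-- `normForm (castVec n) = normFormZ n`. [folklore] -/
theorem normForm_castVec (n : ℤ × ℤ × ℤ) : normForm (castVec n) = (normFormZ n : ℝ) := by
  simp only [normForm, normFormZ, castVec]; push_cast; ring

/-- `max(|adjA|, |adjB|, |adjC|)` of an integer vector, as a real. [cite: HeathBrownActa2001, §12 p. 74] -/
def adjMax (n : ℤ × ℤ × ℤ) : ℝ := max |(adjA n : ℝ)| (max |(adjB n : ℝ)| |(adjC n : ℝ)|)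

/-- The adjugates of the cast are the casts of the adjugates. [folklore] -/
theorem adjR_castVec (n : ℤ × ℤ × ℤ) :
    adjAR (castVec n) = (adjA n : ℝ) ∧ adjBR (castVec n) = (adjB n : ℝ) ∧ adjCR (castVec n) = (adjC n : ℝ) := by
  simp only [adjAR, adjBR, adjCR, adjA, adjB, adjC, castVec]; push_cast; exact ⟨rfl, rfl, rfl⟩

/-- **"`|∇F(𝐧)| ≫ N²`"**: `|N(𝐧)| ≤ 5 |𝐧|_∞ · adjMax(𝐧)`. [cite: HeathBrownActa2001, §12 p. 74] -/
theorem abs_normFormZ_le (n : ℤ × ℤ × ℤ) : |(normFormZ n : ℝ)| ≤ 5 * (supZ n : ℝ) * adjMax n := by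
  obtain ⟨h1, h2, h3⟩ := abs_cast_le_supZ n
  have h := abs_normForm_le_five_mul (b := castVec n) (M := (supZ n : ℝ)) h1 h2 h3
  obtain ⟨eA, eB, eC⟩ := adjR_castVec n
  rw [normForm_castVec, eA, eB, eC] at h
  exact h

/-- `#((A × B).filter P) = ∑_{a ∈ A} #(B.filter (P (a, ·)))`. [folklore] -/
theorem card_filter_prod_eq_sum {α β : Type*} (A : Finset α) (B : Finset β) (P : α × β → Prop) [DecidablePred P] :
    #((A ×ˢ B).filter P) = ∑ a ∈ A, #(B.filter fun b => P (a, b)) := by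
  rw [card_eq_sum_ones, sum_filter, sum_product]
  refine sum_congr rfl fun a _ => ?_
  rw [card_eq_sum_ones, sum_filter]

/-- Swapping the two indices does not change a count over `A × A`. [folklore] -/
theorem card_swap_filter {α : Type*} (A : Finset α) (P : α × α → Prop) [DecidablePred P] :
    #((A ×ˢ A).filter fun x => P x.swap) = #((A ×ˢ A).filter P) := by
  classical
  refine card_bij' (fun x _ => x.swap) (fun x _ => x.swap) (fun x hx => ?_) (fun x hx => ?_)
    (fun x _ => Prod.swap_swap x) (fun x _ => Prod.swap_swap x)
  · rw [mem_filter, mem_product] at hx ⊢; exact ⟨⟨hx.1.2, hx.1.1⟩, hx.2⟩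
  · rw [mem_filter, mem_product] at hx ⊢
    refine ⟨⟨hx.1.2, hx.1.1⟩, ?_⟩
    rw [Prod.swap_swap]; exact hx.2

/-- Elements of `Nrange N` have coordinates of modulus `≤ 3N + 1` (as reals, relative to the centre `0`).
[folklore] -/
theorem abs_sub_zero_le_of_mem_Nrange {N : ℕ} {n : ℤ × ℤ × ℤ} (h : n ∈ Nrange N) :
    |(n.1 : ℝ) - 0| ≤ 3 * N + 1 ∧ |(n.2.1 : ℝ) - 0| ≤ 3 * N + 1 ∧ |(n.2.2 : ℝ) - 0| ≤ 3 * N + 1 := by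
  obtain ⟨h1, h2, h3⟩ := abs_le_of_mem_cube h
  simp only [sub_zero]
  exact ⟨h1, h2, h3⟩

/-- `supZ n ≤ 3N + 1` on `Nrange N`. [folklore] -/
theorem supZ_le_of_mem_Nrange {N : ℕ} {n : ℤ × ℤ × ℤ} (h : n ∈ Nrange N) : (supZ n : ℝ) ≤ 3 * N + 1 :=
  supZ_le_of_mem_cube h

/-- **`adjMax(𝐧) ≥ N²/40`** when `|N(𝐧)| ≥ N³/2` and `𝐧 ∈ Nrange N` (`N ≥ 1`). [cite: HeathBrownActa2001, §12 p. 74] -/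
theorem adjMax_ge {N : ℕ} (hN : 1 ≤ N) {n : ℤ × ℤ × ℤ} (hn : n ∈ Nrange N)
    (hbig : (N : ℝ) ^ 3 / 2 ≤ |(normFormZ n : ℝ)|) : (N : ℝ) ^ 2 / 40 ≤ adjMax n := by
  have hNR : (1 : ℝ) ≤ N := by exact_mod_cast hN
  have h5 := abs_normFormZ_le n
  have hs := supZ_le_of_mem_Nrange hn
  have hs4 : (supZ n : ℝ) ≤ 4 * N := by linarith
  have hadj0 : 0 ≤ adjMax n := (abs_nonneg _).trans (le_max_left _ _)
  have : (N : ℝ) ^ 3 / 2 ≤ 5 * (4 * N) * adjMax n := by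
    calc (N : ℝ) ^ 3 / 2 ≤ |(normFormZ n : ℝ)| := hbig
      _ ≤ 5 * (supZ n : ℝ) * adjMax n := h5
      _ ≤ 5 * (4 * N) * adjMax n := by gcongr
  have hN0 : (0 : ℝ) < N := by linarith
  rw [div_le_iff₀ (by norm_num : (0:ℝ) < 40)]
  nlinarith [hN0, sq_nonneg (N : ℝ)]

/-- `(2(3N+1)+1)² = (6N+3)²` and friends: the basic size of `Nrange`. [folklore] -/
theorem card_Nrange_le' (N : ℕ) : (#(Nrange N) : ℝ) ≤ (6 * (N : ℝ) + 3) ^ 3 := card_Nrange_le N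

/-! ### Linear conditions: the window (`ell`) -/

open scoped Classical in
/-- **The window boundary is met by `O(N⁵)` hypercubes**: `#{(𝐧,𝐧') ∈ Nrange² : |ell(𝐧) − h| ≤ 8} ≤ 12 (6N+3)⁵`
(a slab for `𝐧`, anything for `𝐧'`). [cite: HeathBrownActa2001, §12 p. 73] -/
theorem card_ell_near_le (N : ℕ) (h : ℝ) :
    (#((Nrange N ×ˢ Nrange N).filter fun nn => |ell (castVec nn.1) - h| ≤ 8) : ℝ) ≤ 12 * (6 * (N : ℝ) + 3) ^ 5 := by
  classical
  have hρ := rho_gt; have hρ' := rho_lt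
  have hρ2 : (3 : ℝ) / 2 < rho ^ 2 := by nlinarith
  -- the slab count for `𝐧`
  have hslab : (#((Nrange N).filter fun n => |ell (castVec n) - h| ≤ 8) : ℝ) ≤ (2 * (3 * (N : ℝ) + 1) + 1) ^ 2 * (2 * 8 / rho ^ 2 + 1) := by
    have hA : max |(1 : ℝ)| (max |rho| |rho ^ 2|) = rho ^ 2 := by
      rw [abs_one, abs_of_pos rho_pos, abs_of_pos (by positivity)]
      rw [max_eq_right (le_max_of_le_right (by nlinarith)), max_eq_right (by nlinarith)]
    have key := card_filter_abs_dot_sub_le ((1 : ℝ), rho, rho ^ 2) (by positivity) hA h (by norm_num : (0:ℝ) ≤ 8)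
      (by positivity : (0 : ℝ) ≤ 3 * N + 1) (0, 0, 0) (Nrange N)
    refine le_trans ?_ key
    refine Nat.cast_le.mpr (card_le_card fun n hn => ?_)
    rw [mem_filter] at hn ⊢
    refine ⟨hn.1, abs_sub_zero_le_of_mem_Nrange hn.1, ?_⟩
    have : ell (castVec n) = 1 * n.1 + rho * n.2.1 + rho ^ 2 * n.2.2 := by simp [ell, castVec]
    rw [← this]; exact hn.2
  rw [filter_product_left (fun n : ℤ × ℤ × ℤ => |ell (castVec n) - h| ≤ 8), card_product, Nat.cast_mul]
  have h16 : 2 * 8 / rho ^ 2 + 1 ≤ 12 := by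
    rw [div_add_one (by positivity), div_le_iff₀ (by positivity)]; nlinarith
  have hNr := card_Nrange_le' N
  have e : (2 * (3 * (N : ℝ) + 1) + 1) ^ 2 = (6 * (N : ℝ) + 3) ^ 2 := by ring
  rw [e] at hslab
  calc (#((Nrange N).filter fun n => |ell (castVec n) - h| ≤ 8) : ℝ) * #(Nrange N)
      ≤ ((6 * (N : ℝ) + 3) ^ 2 * (2 * 8 / rho ^ 2 + 1)) * (6 * (N : ℝ) + 3) ^ 3 := by
        gcongr
    _ ≤ ((6 * (N : ℝ) + 3) ^ 2 * 12) * (6 * (N : ℝ) + 3) ^ 3 := by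
        gcongr
    _ = 12 * (6 * (N : ℝ) + 3) ^ 5 := by ring

/-! ### Conditions linear in `𝐧'`: `p₁`, `q₁` -/

open scoped Classical in
/-- The slab count in `𝐧'` for a fixed `𝐧` with a large gradient vector `g ∈ ℤ³`:
`#{𝐧' ∈ Nrange : |g·𝐧' − h| ≤ w} ≤ (6N+3)²(2w/G + 1)` when `|g|_∞ ≥ G > 0`. [cite: HeathBrownActa2001, §12 p. 74] -/
theorem card_dot_near_le {N : ℕ} {g : ℤ × ℤ × ℤ} {G : ℝ} (hG : 0 < G) (hg : G ≤ (supZ g : ℝ)) (h : ℝ) {w : ℝ} (hw : 0 ≤ w) :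
    (#((Nrange N).filter fun n' => |(dot3 g n' : ℝ) - h| ≤ w) : ℝ) ≤ (6 * (N : ℝ) + 3) ^ 2 * (2 * w / G + 1) := by
  classical
  set A : ℝ := (supZ g : ℝ) with hA
  have hApos : 0 < A := lt_of_lt_of_le hG hg
  have hmax : max |((g.1 : ℤ) : ℝ)| (max |((g.2.1 : ℤ) : ℝ)| |((g.2.2 : ℤ) : ℝ)|) = A := by
    rw [hA]; simp only [supZ]; push_cast; rfl
  have key := card_filter_abs_dot_sub_le (((g.1 : ℤ) : ℝ), ((g.2.1 : ℤ) : ℝ), ((g.2.2 : ℤ) : ℝ)) hApos hmax h hw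
    (by positivity : (0 : ℝ) ≤ 3 * N + 1) (0, 0, 0) (Nrange N)
  have hsub : (#((Nrange N).filter fun n' => |(dot3 g n' : ℝ) - h| ≤ w) : ℝ) ≤
      #((Nrange N).filter (fun n' => (|(n'.1 : ℝ) - (0 : ℝ × ℝ × ℝ).1| ≤ 3 * N + 1 ∧
        |(n'.2.1 : ℝ) - (0 : ℝ × ℝ × ℝ).2.1| ≤ 3 * N + 1 ∧ |(n'.2.2 : ℝ) - (0 : ℝ × ℝ × ℝ).2.2| ≤ 3 * N + 1) ∧
        |((g.1 : ℤ) : ℝ) * n'.1 + ((g.2.1 : ℤ) : ℝ) * n'.2.1 + ((g.2.2 : ℤ) : ℝ) * n'.2.2 - h| ≤ w)) := by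
    refine Nat.cast_le.mpr (card_le_card fun n hn => ?_)
    rw [mem_filter] at hn ⊢
    refine ⟨hn.1, abs_sub_zero_le_of_mem_Nrange hn.1, ?_⟩
    have : (dot3 g n : ℝ) = ((g.1 : ℤ) : ℝ) * n.1 + ((g.2.1 : ℤ) : ℝ) * n.2.1 + ((g.2.2 : ℤ) : ℝ) * n.2.2 := by
      simp [dot3]
    rw [← this]; exact hn.2
  refine hsub.trans (key.trans ?_)
  have e : (2 * (3 * (N : ℝ) + 1) + 1) ^ 2 = (6 * (N : ℝ) + 3) ^ 2 := by ring
  rw [e]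
  gcongr

/-- `|gradP 𝐧|_∞ ≥ adjMax 𝐧` and `|gradQ 𝐧|_∞ ≥ adjMax 𝐧`. [cite: HeathBrownActa2001, §12 p. 74] -/
theorem adjMax_le_supZ_grad (n : ℤ × ℤ × ℤ) : adjMax n ≤ (supZ (gradP n) : ℝ) ∧ adjMax n ≤ (supZ (gradQ n) : ℝ) := by
  have hP := max_adj_le_sup_gradPR (castVec n)
  have hQ := max_adj_le_sup_gradQR (castVec n)
  obtain ⟨eA, eB, eC⟩ := adjR_castVec n
  rw [eA, eB, eC] at hP hQ
  have e1 : ((supZ (gradP n) : ℤ) : ℝ) = max |((gradPR (castVec n)).1)| (max |(gradPR (castVec n)).2.1| |(gradPR (castVec n)).2.2|) := by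
    simp only [supZ, gradP, gradPR, eA, eB, eC]; push_cast; rfl
  have e2 : ((supZ (gradQ n) : ℤ) : ℝ) = max |((gradQR (castVec n)).1)| (max |(gradQR (castVec n)).2.1| |(gradQR (castVec n)).2.2|) := by
    simp only [supZ, gradQ, gradQR, eA, eB, eC]; push_cast; rfl
  rw [adjMax, e1, e2]
  exact ⟨hP, hQ⟩

open scoped Classical in
/-- **The boundary `p₁ = XD` (or `XD(1+η)`) is met by `O(N⁵)` hypercubes**:
`#{(𝐧,𝐧') ∈ Nrange² : |p₁(𝐧,𝐧') − h| ≤ 8000N², |N(𝐧)| ≥ N³/2} ≤ 640001 (6N+3)⁵` (for each admissible `𝐧`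
the condition is a slab in `𝐧'` of bounded width, as `|∇_{𝐧'}p₁| = |gradP 𝐧|_∞ ≥ N²/40`).
[cite: HeathBrownActa2001, §12 p. 74] -/
theorem card_p1_near_le {N : ℕ} (hN : 1 ≤ N) (h : ℝ) :
    (#((Nrange N ×ˢ Nrange N).filter fun nn => |(p1Z nn.1 nn.2 : ℝ) - h| ≤ 8000 * (N : ℝ) ^ 2 ∧
        (N : ℝ) ^ 3 / 2 ≤ |(normFormZ nn.1 : ℝ)|) : ℝ) ≤ 640001 * (6 * (N : ℝ) + 3) ^ 5 := by
  classical
  have hNR : (1 : ℝ) ≤ N := by exact_mod_cast hN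
  rw [card_filter_prod_eq_sum, Nat.cast_sum]
  have hterm : ∀ n ∈ Nrange N, (#((Nrange N).filter fun n' => |(p1Z n n' : ℝ) - h| ≤ 8000 * (N : ℝ) ^ 2 ∧
      (N : ℝ) ^ 3 / 2 ≤ |(normFormZ n : ℝ)|) : ℝ) ≤ (6 * (N : ℝ) + 3) ^ 2 * 640001 := by
    intro n hn
    by_cases hbig : (N : ℝ) ^ 3 / 2 ≤ |(normFormZ n : ℝ)|
    · have hG := adjMax_ge hN hn hbig
      have hG' : (N : ℝ) ^ 2 / 40 ≤ (supZ (gradP n) : ℝ) := hG.trans (adjMax_le_supZ_grad n).1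
      have key := card_dot_near_le (N := N) (g := gradP n) (by positivity : (0 : ℝ) < N ^ 2 / 40) hG' h
        (by positivity : (0 : ℝ) ≤ 8000 * N ^ 2)
      refine le_trans ?_ (key.trans ?_)
      · refine Nat.cast_le.mpr (card_le_card fun n' hn' => ?_)
        rw [mem_filter] at hn' ⊢
        refine ⟨hn'.1, ?_⟩
        rw [← p1Z_eq]; exact hn'.2.1
      · have : 2 * (8000 * (N : ℝ) ^ 2) / (N ^ 2 / 40) + 1 = 640001 := by
          field_simp; ring
        rw [this]
    · have : (Nrange N).filter (fun n' => |(p1Z n n' : ℝ) - h| ≤ 8000 * (N : ℝ) ^ 2 ∧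
          (N : ℝ) ^ 3 / 2 ≤ |(normFormZ n : ℝ)|) = ∅ := by
        rw [filter_eq_empty_iff]; intro n' _ hh; exact hbig hh.2
      rw [this, card_empty, Nat.cast_zero]; positivity
  calc ∑ n ∈ Nrange N, (#((Nrange N).filter fun n' => |(p1Z n n' : ℝ) - h| ≤ 8000 * (N : ℝ) ^ 2 ∧
          (N : ℝ) ^ 3 / 2 ≤ |(normFormZ n : ℝ)|) : ℝ)
      ≤ ∑ _n ∈ Nrange N, (6 * (N : ℝ) + 3) ^ 2 * 640001 := sum_le_sum hterm
    _ = #(Nrange N) * ((6 * (N : ℝ) + 3) ^ 2 * 640001) := by rw [sum_const, nsmul_eq_mul]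
    _ ≤ (6 * (N : ℝ) + 3) ^ 3 * ((6 * (N : ℝ) + 3) ^ 2 * 640001) := by gcongr; exact card_Nrange_le' N
    _ = 640001 * (6 * (N : ℝ) + 3) ^ 5 := by ring

open scoped Classical in
/-- The same for `q₁ = −gradQ(𝐧)·𝐧'`. [cite: HeathBrownActa2001, §12 p. 74] -/
theorem card_q1_near_le {N : ℕ} (hN : 1 ≤ N) (h : ℝ) :
    (#((Nrange N ×ˢ Nrange N).filter fun nn => |(q1Z nn.1 nn.2 : ℝ) - h| ≤ 8000 * (N : ℝ) ^ 2 ∧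
        (N : ℝ) ^ 3 / 2 ≤ |(normFormZ nn.1 : ℝ)|) : ℝ) ≤ 640001 * (6 * (N : ℝ) + 3) ^ 5 := by
  classical
  have hNR : (1 : ℝ) ≤ N := by exact_mod_cast hN
  rw [card_filter_prod_eq_sum, Nat.cast_sum]
  have hterm : ∀ n ∈ Nrange N, (#((Nrange N).filter fun n' => |(q1Z n n' : ℝ) - h| ≤ 8000 * (N : ℝ) ^ 2 ∧
      (N : ℝ) ^ 3 / 2 ≤ |(normFormZ n : ℝ)|) : ℝ) ≤ (6 * (N : ℝ) + 3) ^ 2 * 640001 := by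
    intro n hn
    by_cases hbig : (N : ℝ) ^ 3 / 2 ≤ |(normFormZ n : ℝ)|
    · have hG := adjMax_ge hN hn hbig
      have hG' : (N : ℝ) ^ 2 / 40 ≤ (supZ (gradQ n) : ℝ) := hG.trans (adjMax_le_supZ_grad n).2
      have key := card_dot_near_le (N := N) (g := gradQ n) (by positivity : (0 : ℝ) < N ^ 2 / 40) hG' (-h)
        (by positivity : (0 : ℝ) ≤ 8000 * N ^ 2)
      refine le_trans ?_ (key.trans ?_)
      · refine Nat.cast_le.mpr (card_le_card fun n' hn' => ?_)
        rw [mem_filter] at hn' ⊢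
        refine ⟨hn'.1, ?_⟩
        have e : |(dot3 (gradQ n) n' : ℝ) - -h| = |(q1Z n n' : ℝ) - h| := by
          rw [q1Z_eq]; push_cast; rw [← abs_neg]; ring_nf
        rw [e]; exact hn'.2.1
      · have : 2 * (8000 * (N : ℝ) ^ 2) / (N ^ 2 / 40) + 1 = 640001 := by
          field_simp; ring
        rw [this]
    · have : (Nrange N).filter (fun n' => |(q1Z n n' : ℝ) - h| ≤ 8000 * (N : ℝ) ^ 2 ∧
          (N : ℝ) ^ 3 / 2 ≤ |(normFormZ n : ℝ)|) = ∅ := by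
        rw [filter_eq_empty_iff]; intro n' _ hh; exact hbig hh.2
      rw [this, card_empty, Nat.cast_zero]; positivity
  calc ∑ n ∈ Nrange N, (#((Nrange N).filter fun n' => |(q1Z n n' : ℝ) - h| ≤ 8000 * (N : ℝ) ^ 2 ∧
          (N : ℝ) ^ 3 / 2 ≤ |(normFormZ n : ℝ)|) : ℝ)
      ≤ ∑ _n ∈ Nrange N, (6 * (N : ℝ) + 3) ^ 2 * 640001 := sum_le_sum hterm
    _ = #(Nrange N) * ((6 * (N : ℝ) + 3) ^ 2 * 640001) := by rw [sum_const, nsmul_eq_mul]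
    _ ≤ (6 * (N : ℝ) + 3) ^ 3 * ((6 * (N : ℝ) + 3) ^ 2 * 640001) := by gcongr; exact card_Nrange_le' N
    _ = 640001 * (6 * (N : ℝ) + 3) ^ 5 := by ring

/-! ### The cubic condition `N(β) = V, 2V` -/

open scoped Classical in
/-- **The one-variable count, fibred**: for a set `S'` of integer vectors with the two "other" coordinates
in `[-R, R]²` and, along the "variable" coordinate `t`, `|t| ≤ R`, `|αt³ + β t − h'| ≤ w`, `|3αt² + β| ≥ g`
(`β`, `h'` depending on the other coordinates), `#S' ≤ (2R+1)² (12αR²/g + 1)(4w/g + 1)` (Lemma 4.9's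
"`#ℬ₁(𝐮) ≪ 1`" summed over `𝐮`). [cite: HeathBrownActa2001, Lemma 4.9] -/
theorem card_le_of_cubic_fibred (S' : Finset (ℤ × ℤ × ℤ)) (var : ℤ × ℤ × ℤ → ℤ) (oth : ℤ × ℤ × ℤ → ℤ × ℤ)
    (hinj : ∀ n n', var n = var n' → oth n = oth n' → n = n') {R : ℤ} (hR : 0 < R) {α g w : ℝ} (hα : 0 < α)
    (hg : 0 < g) (hw : 0 ≤ w) (β h' : ℤ × ℤ → ℝ)
    (hoth : ∀ n ∈ S', oth n ∈ Icc (-R) R ×ˢ Icc (-R) R)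
    (hvar : ∀ n ∈ S', |(var n : ℝ)| ≤ R ∧ |α * (var n : ℝ) ^ 3 + β (oth n) * var n - h' (oth n)| ≤ w ∧
      g ≤ |3 * α * (var n : ℝ) ^ 2 + β (oth n)|) :
    (#S' : ℝ) ≤ (2 * R + 1) ^ 2 * ((12 * α * R ^ 2 / g + 1) * (4 * w / g + 1)) := by
  classical
  have hRr : (0 : ℝ) < R := by exact_mod_cast hR
  have hfib : ∀ o ∈ S'.image oth, (#(S'.filter fun n => oth n = o) : ℝ) ≤ (12 * α * R ^ 2 / g + 1) * (4 * w / g + 1) := by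
    intro o _
    set F := S'.filter (fun n => oth n = o) with hF
    have hinjF : Set.InjOn var (F : Set (ℤ × ℤ × ℤ)) := by
      intro n hn n' hn' hv
      simp only [hF, coe_filter, Set.mem_setOf_eq] at hn hn'
      exact hinj n n' hv (hn.2.trans hn'.2.symm)
    rw [← card_image_of_injOn hinjF]
    refine card_le_of_cubic_near_level (β := β o) (h := h' o) hα hRr hg hw _ fun t ht => ?_
    obtain ⟨n, hn, rfl⟩ := mem_image.mp ht
    rw [hF, mem_filter] at hn
    obtain ⟨hnS, ho⟩ := hn
    have := hvar n hnS
    rw [ho] at this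
    exact this
  have himg : (#(S'.image oth) : ℝ) ≤ (2 * R + 1) ^ 2 := by
    have hsub : S'.image oth ⊆ Icc (-R) R ×ˢ Icc (-R) R := image_subset_iff.mpr hoth
    have hc := card_le_card hsub
    rw [card_product, Int.card_Icc, show R + 1 - -R = 2 * R + 1 by ring] at hc
    have : (((2 * R + 1).toNat : ℕ) : ℝ) = 2 * R + 1 := by
      have h0 : 0 ≤ 2 * R + 1 := by omega
      rw [show (((2 * R + 1).toNat : ℕ) : ℝ) = (((2 * R + 1).toNat : ℤ) : ℝ) by norm_cast, Int.toNat_of_nonneg h0]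
      push_cast; ring
    calc (#(S'.image oth) : ℝ) ≤ ((2 * R + 1).toNat * (2 * R + 1).toNat : ℕ) := by exact_mod_cast hc
      _ = (2 * R + 1) ^ 2 := by push_cast; rw [this]; ring
  have hsum : #S' = ∑ o ∈ S'.image oth, #(S'.filter fun n => oth n = o) := card_eq_sum_card_image oth S'
  calc (#S' : ℝ) = ∑ o ∈ S'.image oth, (#(S'.filter fun n => oth n = o) : ℝ) := by rw [hsum]; push_cast; rfl
    _ ≤ ∑ _o ∈ S'.image oth, (12 * α * R ^ 2 / g + 1) * (4 * w / g + 1) := sum_le_sum hfib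
    _ = #(S'.image oth) * ((12 * α * R ^ 2 / g + 1) * (4 * w / g + 1)) := by rw [sum_const, nsmul_eq_mul]
    _ ≤ (2 * R + 1) ^ 2 * ((12 * α * R ^ 2 / g + 1) * (4 * w / g + 1)) := by gcongr

/-- Membership in `Nrange N` gives integer coordinate bounds `|n_i| ≤ 3N + 1`. [folklore] -/
theorem mem_Icc_of_mem_Nrange {N : ℕ} {n : ℤ × ℤ × ℤ} (h : n ∈ Nrange N) :
    n.1 ∈ Icc (-(3 * (N : ℤ) + 1)) (3 * N + 1) ∧ n.2.1 ∈ Icc (-(3 * (N : ℤ) + 1)) (3 * N + 1) ∧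
      n.2.2 ∈ Icc (-(3 * (N : ℤ) + 1)) (3 * N + 1) := by
  rw [Nrange, mem_cube_iff] at h
  have hfl : ⌊(3 * (N : ℝ) + 1)⌋ = 3 * (N : ℤ) + 1 := by
    rw [show (3 * (N : ℝ) + 1) = ((3 * (N : ℤ) + 1 : ℤ) : ℝ) by push_cast; ring, Int.floor_intCast]
  rw [hfl] at h
  simp only [mem_Icc, abs_le] at h ⊢
  exact h

open scoped Classical in
/-- **The boundaries `N(β) = V`, `2V` are met by `O(N⁵)` hypercubes**:
`#{(𝐧,𝐧') ∈ Nrange² : |N(𝐧) − h| ≤ 1248N², |N(𝐧)| ≥ N³/2} ≤ 2.1·10⁹ (6N+3)⁵`. At such `𝐧` some adjugate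
is `≥ N²/40` in modulus; along the corresponding coordinate `N(𝐧)` is a cubic `αt³ + βt + γ` with
`α ∈ {1, 2, 4}` and derivative `3·adjA`, `6·adjC`, `6·adjB` ("`∂F/∂x₄ = x₂² − x₁x₃`, …"), so the fibred
cubic count applies. [cite: HeathBrownActa2001, §12 p. 74] -/
theorem card_norm_near_le {N : ℕ} (hN : 1 ≤ N) (h : ℝ) :
    (#((Nrange N ×ˢ Nrange N).filter fun nn => |(normFormZ nn.1 : ℝ) - h| ≤ 1248 * (N : ℝ) ^ 2 ∧
        (N : ℝ) ^ 3 / 2 ≤ |(normFormZ nn.1 : ℝ)|) : ℝ) ≤ 2100000000 * (6 * (N : ℝ) + 3) ^ 5 := by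
  classical
  have hNR : (1 : ℝ) ≤ N := by exact_mod_cast hN
  set w : ℝ := 1248 * (N : ℝ) ^ 2 with hw
  set S := (Nrange N).filter (fun n => |(normFormZ n : ℝ) - h| ≤ w ∧ (N : ℝ) ^ 3 / 2 ≤ |(normFormZ n : ℝ)|) with hS
  rw [filter_product_left (fun n : ℤ × ℤ × ℤ => |(normFormZ n : ℝ) - h| ≤ w ∧ (N : ℝ) ^ 3 / 2 ≤ |(normFormZ n : ℝ)|),
    card_product, Nat.cast_mul, ← hS]
  -- facts on `S`
  have hSfacts : ∀ n ∈ S, n ∈ Nrange N ∧ |(normFormZ n : ℝ) - h| ≤ w ∧ (N : ℝ) ^ 2 / 40 ≤ adjMax n := by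
    intro n hn
    rw [hS, mem_filter] at hn
    exact ⟨hn.1, hn.2.1, adjMax_ge hN hn.1 hn.2.2⟩
  set R : ℤ := 3 * N + 1 with hR
  have hRpos : 0 < R := by rw [hR]; omega
  have hRr : ((R : ℤ) : ℝ) = 3 * N + 1 := by rw [hR]; push_cast; ring
  set g : ℝ := 3 * ((N : ℝ) ^ 2 / 40) with hg
  have hgpos : 0 < g := by positivity
  -- the three parts
  set SA := S.filter (fun n => adjMax n = |(adjA n : ℝ)|) with hSA
  set SB := S.filter (fun n => adjMax n = |(adjB n : ℝ)|) with hSB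
  set SC := S.filter (fun n => adjMax n = |(adjC n : ℝ)|) with hSC
  have hcover : S ⊆ SA ∪ SB ∪ SC := by
    intro n hn
    rw [mem_union, mem_union]
    rcases max_choice |(adjA n : ℝ)| (max |(adjB n : ℝ)| |(adjC n : ℝ)|) with h1 | h1
    · left; left; exact mem_filter.mpr ⟨hn, h1⟩
    · rcases max_choice |(adjB n : ℝ)| |(adjC n : ℝ)| with h2 | h2
      · left; right; exact mem_filter.mpr ⟨hn, h1.trans h2⟩
      · right; exact mem_filter.mpr ⟨hn, h1.trans h2⟩
  -- common bound shape
  have hK : ∀ (α : ℝ), 0 < α → α ≤ 4 →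
      (2 * (R : ℝ) + 1) ^ 2 * ((12 * α * (R : ℝ) ^ 2 / g + 1) * (4 * w / g + 1)) ≤ 700000000 * (6 * (N : ℝ) + 3) ^ 2 := by
    intro α hα hα4
    rw [hRr]
    have e1 : 12 * α * (3 * (N : ℝ) + 1) ^ 2 / g + 1 ≤ 10241 := by
      have hα' : 12 * α * (3 * (N : ℝ) + 1) ^ 2 ≤ 12 * 4 * (3 * (N : ℝ) + 1) ^ 2 := by gcongr
      rw [hg, div_add_one (by positivity), div_le_iff₀ (by positivity)]
      nlinarith [mul_nonneg (by linarith : (0:ℝ) ≤ 7 * N + 1) (by linarith : (0:ℝ) ≤ N - 1)]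
    have e2 : 4 * w / g + 1 = 66561 := by rw [hw, hg]; field_simp; ring
    rw [e2]
    have e3 : (2 * (3 * (N : ℝ) + 1) + 1) ^ 2 = (6 * (N : ℝ) + 3) ^ 2 := by ring
    rw [e3]
    have h0 : (0 : ℝ) ≤ (6 * (N : ℝ) + 3) ^ 2 := by positivity
    have hc : (10241 : ℝ) * 66561 ≤ 700000000 := by norm_num
    calc (6 * (N : ℝ) + 3) ^ 2 * ((12 * α * (3 * (N : ℝ) + 1) ^ 2 / g + 1) * 66561)
        ≤ (6 * (N : ℝ) + 3) ^ 2 * (10241 * 66561) := by gcongr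
      _ ≤ 700000000 * (6 * (N : ℝ) + 3) ^ 2 := by nlinarith
  -- part A: variable `n.1`
  have hA : (#SA : ℝ) ≤ 700000000 * (6 * (N : ℝ) + 3) ^ 2 := by
    refine le_trans (card_le_of_cubic_fibred SA Prod.fst (fun n => (n.2.1, n.2.2))
      (fun n n' h1 h2 => by
        have := Prod.ext_iff.mp h2; exact Prod.ext h1 (Prod.ext this.1 this.2))
      hRpos one_pos hgpos (by positivity) (fun o => -6 * (o.1 : ℝ) * o.2)
      (fun o => h - (2 * (o.1 : ℝ) ^ 3 + 4 * (o.2 : ℝ) ^ 3)) (fun n hn => ?_) (fun n hn => ?_)) (hK 1 one_pos (by norm_num))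
    · rw [hSA, mem_filter] at hn
      obtain ⟨-, h2, h3⟩ := mem_Icc_of_mem_Nrange (hSfacts n hn.1).1
      exact mem_product.mpr ⟨h2, h3⟩
    · rw [hSA, mem_filter] at hn
      obtain ⟨hnS, hmax⟩ := hn
      obtain ⟨hnr, hnear, hadj⟩ := hSfacts n hnS
      obtain ⟨b1, -, -⟩ := abs_cast_le_supZ n
      refine ⟨b1.trans (by rw [hRr]; exact supZ_le_of_mem_Nrange hnr), ?_, ?_⟩
      · have e : 1 * (n.1 : ℝ) ^ 3 + -6 * (n.2.1 : ℝ) * n.2.2 * n.1 - (h - (2 * (n.2.1 : ℝ) ^ 3 + 4 * (n.2.2 : ℝ) ^ 3)) =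
            (normFormZ n : ℝ) - h := by simp only [normFormZ]; push_cast; ring
        rw [e]; exact hnear
      · have e : 3 * 1 * (n.1 : ℝ) ^ 2 + -6 * (n.2.1 : ℝ) * n.2.2 = 3 * (adjA n : ℝ) := by
          simp only [adjA]; push_cast; ring
        rw [e, abs_mul, abs_of_pos (by norm_num : (0:ℝ) < 3), ← hmax, hg]
        linarith
  -- part B: variable `n.2.2`
  have hB : (#SB : ℝ) ≤ 700000000 * (6 * (N : ℝ) + 3) ^ 2 := by
    refine le_trans (card_le_of_cubic_fibred SB (fun n => n.2.2) (fun n => (n.1, n.2.1))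
      (fun n n' h1 h2 => by
        have := Prod.ext_iff.mp h2; exact Prod.ext this.1 (Prod.ext this.2 h1))
      hRpos (by norm_num : (0:ℝ) < 4) hgpos (by positivity) (fun o => -6 * (o.1 : ℝ) * o.2)
      (fun o => h - ((o.1 : ℝ) ^ 3 + 2 * (o.2 : ℝ) ^ 3)) (fun n hn => ?_) (fun n hn => ?_)) (hK 4 (by norm_num) le_rfl)
    · rw [hSB, mem_filter] at hn
      obtain ⟨h1, h2, -⟩ := mem_Icc_of_mem_Nrange (hSfacts n hn.1).1
      exact mem_product.mpr ⟨h1, h2⟩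
    · rw [hSB, mem_filter] at hn
      obtain ⟨hnS, hmax⟩ := hn
      obtain ⟨hnr, hnear, hadj⟩ := hSfacts n hnS
      obtain ⟨-, -, b3⟩ := abs_cast_le_supZ n
      refine ⟨b3.trans (by rw [hRr]; exact supZ_le_of_mem_Nrange hnr), ?_, ?_⟩
      · have e : 4 * (n.2.2 : ℝ) ^ 3 + -6 * (n.1 : ℝ) * n.2.1 * n.2.2 - (h - ((n.1 : ℝ) ^ 3 + 2 * (n.2.1 : ℝ) ^ 3)) =
            (normFormZ n : ℝ) - h := by simp only [normFormZ]; push_cast; ring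
        rw [e]; exact hnear
      · have e : 3 * 4 * (n.2.2 : ℝ) ^ 2 + -6 * (n.1 : ℝ) * n.2.1 = 6 * (adjB n : ℝ) := by
          simp only [adjB]; push_cast; ring
        rw [e, abs_mul, abs_of_pos (by norm_num : (0:ℝ) < 6), ← hmax, hg]
        linarith
  -- part C: variable `n.2.1`
  have hC : (#SC : ℝ) ≤ 700000000 * (6 * (N : ℝ) + 3) ^ 2 := by
    refine le_trans (card_le_of_cubic_fibred SC (fun n => n.2.1) (fun n => (n.1, n.2.2))
      (fun n n' h1 h2 => by
        have := Prod.ext_iff.mp h2; exact Prod.ext this.1 (Prod.ext h1 this.2))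
      hRpos (by norm_num : (0:ℝ) < 2) hgpos (by positivity) (fun o => -6 * (o.1 : ℝ) * o.2)
      (fun o => h - ((o.1 : ℝ) ^ 3 + 4 * (o.2 : ℝ) ^ 3)) (fun n hn => ?_) (fun n hn => ?_)) (hK 2 (by norm_num) (by norm_num))
    · rw [hSC, mem_filter] at hn
      obtain ⟨h1, -, h3⟩ := mem_Icc_of_mem_Nrange (hSfacts n hn.1).1
      exact mem_product.mpr ⟨h1, h3⟩
    · rw [hSC, mem_filter] at hn
      obtain ⟨hnS, hmax⟩ := hn
      obtain ⟨hnr, hnear, hadj⟩ := hSfacts n hnS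
      obtain ⟨-, b2, -⟩ := abs_cast_le_supZ n
      refine ⟨b2.trans (by rw [hRr]; exact supZ_le_of_mem_Nrange hnr), ?_, ?_⟩
      · have e : 2 * (n.2.1 : ℝ) ^ 3 + -6 * (n.1 : ℝ) * n.2.2 * n.2.1 - (h - ((n.1 : ℝ) ^ 3 + 4 * (n.2.2 : ℝ) ^ 3)) =
            (normFormZ n : ℝ) - h := by simp only [normFormZ]; push_cast; ring
        rw [e]; exact hnear
      · have e : 3 * 2 * (n.2.1 : ℝ) ^ 2 + -6 * (n.1 : ℝ) * n.2.2 = 6 * (adjC n : ℝ) := by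
          simp only [adjC]; push_cast; ring
        rw [e, abs_mul, abs_of_pos (by norm_num : (0:ℝ) < 6), ← hmax, hg]
        linarith
  have hScard : (#S : ℝ) ≤ 2100000000 * (6 * (N : ℝ) + 3) ^ 2 := by
    calc (#S : ℝ) ≤ #(SA ∪ SB ∪ SC) := by exact_mod_cast card_le_card hcover
      _ ≤ #SA + #SB + #SC := by
          have h1 := card_union_le (SA ∪ SB) SC
          have h2 := card_union_le SA SB
          have : (#(SA ∪ SB ∪ SC) : ℝ) ≤ #(SA ∪ SB) + #SC := by exact_mod_cast h1
          have : (#(SA ∪ SB) : ℝ) ≤ #SA + #SB := by exact_mod_cast h2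
          linarith
      _ ≤ _ := by linarith
  calc (#S : ℝ) * #(Nrange N) ≤ (2100000000 * (6 * (N : ℝ) + 3) ^ 2) * (6 * (N : ℝ) + 3) ^ 3 := by
        gcongr; exact card_Nrange_le' N
    _ = 2100000000 * (6 * (N : ℝ) + 3) ^ 5 := by ring

end Literature.NumberTheory.Sieve.CubicSieve

end
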